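import Summits.AtomisticToContinuum.FouriersLaw.Theses.PhononMeanFreePath
import Summits.AtomisticToContinuum.FouriersLaw.Theorems.OddSectorIrreversibilityWitnessGlueReflection
import Literature.MathematicalPhysics.KineticTheory.ChainReflection
import Literature.MathematicalPhysics.KineticTheory.LangevinChainKernel
import Literature.MathematicalPhysics.KineticTheory.LangevinChainGibbs

/-!
# `CoherentDephasing` / line `Sketch` (strict absorption): reflection symmetry of the equilibrium
pair correlation (sub-goal K1, stub `sa_reflect`)

Support file for stub `sa_reflect` of the lead's `N`-uniform strict-absorption skeleton for crux
`stmt-AtomisticToContinuum-11810` (`PhononMeanFreePath.CoherentDephasing`). Nothing here closes an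
item.

For the `(N+1)`-site chain `P = pinnedChain ω₂ lam β γ` with BOTH Langevin baths at the same
temperature `T`, the site reflection `σ : (q, p) ↦ (q ∘ rev, p ∘ rev)` (`siteReflection`,
`Literature/MathematicalPhysics/KineticTheory/ChainReflection.lean`) is a symmetry of the
CONSTRUCTED objects the crux is typed with:

* the transition kernels `K_t = P.transitionKernel (N+1) T T t` satisfy `K_t(σ x, ·) = σ_* K_t(x, ·)`
  (`OddSectorWitness.transitionKernel_siteReflection`: the reflected pathwise solution solves the
  Langevin integral equation driven by the SWAPPED pair of Brownian paths — uniqueness of the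
  integral equation — and the product Wiener measure is swap invariant), whence
  `(K_t g)(σ x) = (K_t (g ∘ σ))(x)` for every observable `g` (`reflect_integral_transitionKernel`);
* the Gibbs measure `μ = P.gibbsMeasure (N+1) T` is `σ`-invariant: `H ∘ σ = H` (even FPU
  interaction, `hamiltonian_siteReflection`) and `σ` is a coordinate permutation preserving
  Lebesgue measure (`OddSectorWitness.measurePreserving_siteReflection_volume`), whence
  `E_μ[g ∘ σ] = E_μ[g]` for every `g` (`reflect_integral_gibbsMeasure`).

Consequently, with `(σ z).2 0 = z.2 (last N)` and `(σ z).2 (last N) = z.2 0`,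

  `∫ p_0 · K_t p_N dμ = ∫ (p_0 ∘ σ) · (K_t p_N) ∘ σ dμ = ∫ p_N · K_t (p_N ∘ σ) dμ = ∫ p_N · K_t p_0 dμ`,

as Bochner integrals, junk values included (every step transports an integrand along a measurable
involution, so no integrability is needed): this is `sa_reflect`.
-/

noncomputable section

open MeasureTheory ProbabilityTheory Filter Topology Set
open scoped NNReal ENNReal

namespace Summit.AtomisticToContinuum.FouriersLaw.Theorems.CoherentDephasing.StrictAbsorption

open Literature.MathematicalPhysics.KineticTheory.HeatConduction
open Literature.MathematicalPhysics.KineticTheory Literature.Probability.Process OscillatorChain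
open Summit.AtomisticToContinuum.FouriersLaw.Theorems.OddSectorWitness
  (transitionKernel_siteReflection measurePreserving_siteReflection_volume)

variable {ω₂ lam β γ : ℝ}

/-- **Reflection covariance of the kernel averages** at equal bath temperatures:
`(K_t g)(σ x) = (K_t (g ∘ σ))(x)` for EVERY observable `g` (Bochner integrals against the
constructed kernels of the pinned chain; `K_t(σ x, ·) = σ_* K_t(x, ·)` and `σ` is a measurable
involution, so neither measurability nor integrability of `g` is needed — junk values agree).
[folklore] -/
theorem reflect_integral_transitionKernel (hω : 0 < ω₂) (hl : 0 ≤ lam) (hβ : 0 ≤ β) (hγ : 0 ≤ γ)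
    (n : ℕ) (T : ℝ) (t : ℝ≥0) (x : PhaseSpace n) (g : PhaseSpace n → ℝ) :
    ∫ y, g y ∂((pinnedChain ω₂ lam β γ).transitionKernel n T T t (siteReflection n x)) =
      ∫ y, g (siteReflection n y) ∂((pinnedChain ω₂ lam β γ).transitionKernel n T T t x) := by
  rw [transitionKernel_siteReflection hω hl hβ hγ n T t x]
  exact integral_map_equiv (siteReflectionEquiv n) g

/-- **The Gibbs measure of the pinned chain is reflection invariant**:
`E_{μ_T}[g ∘ σ] = E_{μ_T}[g]` for EVERY `g` and all parameters (both sides are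
`(∫ e^{-H/T})⁻¹ ∫ (·) e^{-H/T} d(q, p)`; `H ∘ σ = H` for the even FPU interaction and `σ`
preserves Lebesgue measure on phase space; junk values agree). [folklore] -/
theorem reflect_integral_gibbsMeasure (n : ℕ) (T : ℝ) (g : PhaseSpace n → ℝ) :
    ∫ x, g (siteReflection n x) ∂((pinnedChain ω₂ lam β γ).gibbsMeasure n T) =
      ∫ x, g x ∂((pinnedChain ω₂ lam β γ).gibbsMeasure n T) := by
  have hρ : ∀ x, (pinnedChain ω₂ lam β γ).gibbsDensity n T (siteReflection n x) =
      (pinnedChain ω₂ lam β γ).gibbsDensity n T x := fun x => by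
    simp only [OscillatorChain.gibbsDensity,
      (pinnedChain ω₂ lam β γ).hamiltonian_siteReflection (pinnedChain_V_neg ω₂ lam β γ)]
  rw [(pinnedChain ω₂ lam β γ).integral_gibbsMeasure, (pinnedChain ω₂ lam β γ).integral_gibbsMeasure]
  congr 1
  have h := (measurePreserving_siteReflection_volume (N := n)).integral_comp
    (siteReflectionEquiv n).measurableEmbedding
    (fun x => g x * (pinnedChain ω₂ lam β γ).gibbsDensity n T x)
  simp only [hρ] at h
  exact h

/-- SUB-GOAL K1 (reflection symmetry of the equilibrium kernels): `⟨p_0, K_t p_N⟩_μ = ⟨p_N, K_t p_0⟩_μ`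
for the `(N+1)`-site chain with both baths at `T` (the site reflection `x ↦ N - x` conjugates the
constructed kernels and preserves the Gibbs measure; `(σ z).2 0 = z.2 (last N)`). Both sides are
Bochner integrals with matching junk values, so no integrability enters. [folklore] -/
theorem sa_reflect :
    ∀ ω₂ lam β γ : ℝ, 0 < ω₂ → 0 < lam → 0 < β → 0 < γ → ∀ T : ℝ, 0 < T → ∀ (N : ℕ) (t : ℝ), ∫ z, z.2 0 * (∫ y, y.2 (Fin.last N) ∂((pinnedChain ω₂ lam β γ).transitionKernel (N + 1) T T t.toNNReal z)) ∂((pinnedChain ω₂ lam β γ).gibbsMeasure (N + 1) T) = ∫ z, z.2 (Fin.last N) * (∫ y, y.2 0 ∂((pinnedChain ω₂ lam β γ).transitionKernel (N + 1) T T t.toNNReal z)) ∂((pinnedChain ω₂ lam β γ).gibbsMeasure (N + 1) T) := by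
  intro ω₂ lam β γ hω hl hβ hγ T _ N t
  rw [← reflect_integral_gibbsMeasure (ω₂ := ω₂) (lam := lam) (β := β) (γ := γ) (N + 1) T
    (fun z => z.2 (Fin.last N) *
      ∫ y, y.2 0 ∂((pinnedChain ω₂ lam β γ).transitionKernel (N + 1) T T t.toNNReal z))]
  refine integral_congr_ae (Eventually.of_forall fun z => ?_)
  simp only [siteReflection_snd, Fin.rev_last]
  rw [reflect_integral_transitionKernel hω hl.le hβ.le hγ.le (N + 1) T t.toNNReal z (fun y => y.2 0)]
  simp only [siteReflection_snd, Fin.rev_zero]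

end Summit.AtomisticToContinuum.FouriersLaw.Theorems.CoherentDephasing.StrictAbsorption

end
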